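import Summits.QuantumFields.BalabanUV.Beta.GAN24.SymContactFaceJump
import Summits.QuantumFields.BalabanUV.Beta.GAN24.SymLinKernelExpansion

/-!
# `BalabanUV.Beta.GAN24.SymContactFaceJumpCommutator` — binder row G-an2-4 ∕ (CONV-C), TRANSFER-III, the (III′) S-slot (b) of the END, born-Λ contact letter `hCg` (road-P2 M.104's
# 3rd hypothesis), TABLE HALF («mksym lane»), PART 2: **THE COMMUTATOR `[𝒬^ρ_{L,sym}, ψ̄]B` OF an1's (0.4)-SYMMETRISED ROOTED AVERAGING `symLinAvgAt ρ` WITH THE BOND MEAN OF A GAUGE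
# FUNCTION, EXPANDED OVER THE BONDS OF THE SUPPORT BOX, AND ITS FACE-JUMP LETTERS FOR BLOCK-CONSTANT AND STAIRCASE GAUGE FUNCTIONS** — the decl-by-decl twin of MY g60
# `ContactFaceJumpCommutator` with `linAvgAt ↦ symLinAvgAt`, `linCountAt ↦ symLinCountAt` (leaf-02 g55's `SymLinKernelExpansion.symLinAvgAt_eq_sum_symLinCountAt` for the expansion,
# PART 1 `SymContactFaceJump` for the two-block letters, an1's `abs_symLinCountAt_le` for the crude mass `(d+1)!·L^{d+1}·ℓ`)
# (G-an2-4 CRUX TEAM (2), leaf prover `b2b-balaban-gan24-formalise-leaf-01`, gen 90)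

WHAT IS PROVED (generic `d`, box root `ρ = toSite r`; [folklore] finite-sum bookkeeping):
* §1 **`commutator_eq_sum`** `symLinAvgAt ρ (ψ̄•B) L μ y − Ψ̄_ρ(μ,y)·symLinAvgAt ρ B L μ y = Σ_{x ∈ nearBox L y} Σ_α (w₄(ψ; α,x; μ,y)·symLinCountAt ρ L μ y (α,x))·B α x`, `abs_commutator_le_of_forall`.
* §2 `abs_commutator_le_of_blockConst`; §3 `abs_commutator_le_of_staircase(_of_le)`; §4 `abs_commutator_dz_le_of_staircase(_of_le)` (NO `J_a·J_b` term); §5 `sum_abs_symLinCountAt_le`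
  (`≤ #nearBox·(d+1)·((d+1)!·(L^{d+1}·ell (d+1) L))`).
NOT HERE: the `q¹_sym`-pairing as a commutator (PART 3 `SymContactLambdaCommutator`), the envelope forms (PART 4 `SymContactLambdaCellBound`), the cells, any count.

NOT IN PRINT; OUR BOOKKEEPING ([folklore]; 0 `def`, 0 cited fact, 0 `def … : Prop`, 0 sorry).  HONEST FRAMING (cell contract, verbatim): «discharging `BetaPertH` makes
Bałaban's UV stability UNCONDITIONAL — a real constructive-QFT result; it is NOT the continuum limit and NOT the Clay problem.»  HONEST DEPENDENCY (verbatim): «continuum YM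
on T⁴ ⇐ BetaPertH ∧ nine spine estimates (0/9 proved); BetaPertH ⇐ (D1) ∧ (D4) ∧ CAP+tail; G-an2-4 gates asym, D1 and NE2/3/4.»  Discharges NO letter of M.104 by itself;
NEVER «G-an2-4 closed» as (CONV-C); NOT D1, NOT `BetaPertH`, NOT continuum, NOT Clay.  2026-08-28; no existing file touched.
-/

noncomputable section

open Finset
open scoped BigOperators
open Literature.MathematicalPhysics.QuantumFieldTheory
open Literature.MathematicalPhysics.QuantumFieldTheory.Balaban1983to89
open Literature.MathematicalPhysics.QuantumFieldTheory.Balaban1983to89.Beta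
open AffineAveraging (Form0 Form1 Site box toSite unitVec unitVec_apply dz)
open AveragingContours (blk blk_block)
open AveragingHessianKernels (ell)
open Summit.QuantumFields.BalabanUV.Beta.SymmetrisedAxialPotential (symLinAvgAt)
open Summit.QuantumFields.BalabanUV.Beta.SymAveragingHessianCounts (symLinCountAt symLinKerAt abs_symLinCountAt_le)
open Summit.QuantumFields.BalabanUV.Beta.LinearGaugeVH (nearBox mem_nearBox)
open Summit.QuantumFields.BalabanUV.Beta.GAN24.SymLinKernelExpansion (symLinAvgAt_eq_sum_symLinCountAt)
open Summit.QuantumFields.BalabanUV.Beta.GAN24.ContactFaceJumpStaircase (staircase_split abs_hplus_jump_le)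
open Summit.QuantumFields.BalabanUV.Beta.GAN24.SymContactFaceJump (abs_weight_mul_symLinCountAt_le abs_weight_mul_dz_staircase_mul_symLinCountAt_le)

namespace Summit.QuantumFields.BalabanUV.Beta.GAN24.SymContactFaceJumpCommutator

variable {d : ℕ} {L : ℕ} {r : Fin (d + 1) → ℕ}

/-! ## §1 The commutator expanded over the bonds of the support box -/

/-- NOT IN PRINT; OUR BOOKKEEPING.  **THE COMMUTATOR OVER BONDS** (box root; every `ψ`, every real 1-form `B`):
`symLinAvgAt ρ (ψ̄•B) L μ y − Ψ̄_ρ(μ,y)·symLinAvgAt ρ B L μ y = Σ_{x ∈ nearBox L y} Σ_α (w₄(ψ; α,x; μ,y)·symLinCountAt ρ L μ y (α,x))·B α x`. -/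
theorem commutator_eq_sum (hr : r ∈ box (d + 1) L) (ψ : Site (d + 1) → ℝ) (B : Form1 (d + 1) ℝ) (μ : Fin (d + 1)) (y : Site (d + 1)) :
    symLinAvgAt (toSite r) (fun α x => (ψ x + ψ (x + unitVec α)) * B α x) L μ y
        - (ψ ((L : ℤ) • y + toSite r) + ψ ((L : ℤ) • y + toSite r + (L : ℤ) • unitVec μ)) * symLinAvgAt (toSite r) B L μ y
      = ∑ x ∈ nearBox L y, ∑ α,
          ((ψ x + ψ (x + unitVec α) - ψ ((L : ℤ) • y + toSite r) - ψ ((L : ℤ) • y + toSite r + (L : ℤ) • unitVec μ))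
            * (symLinCountAt (toSite r) L μ y (α, x) : ℝ)) * B α x := by
  rw [symLinAvgAt_eq_sum_symLinCountAt hr, symLinAvgAt_eq_sum_symLinCountAt hr B, Finset.mul_sum, ← Finset.sum_sub_distrib]
  refine Finset.sum_congr rfl fun x _ => ?_
  rw [Finset.mul_sum, ← Finset.sum_sub_distrib]
  refine Finset.sum_congr rfl fun α _ => ?_
  ring

/-- [folklore] The termwise bound summed: if `|w₄(ψ; α,x; μ,y)·count(α,x)| ≤ F α x·|count(α,x)|` for every bond then
`|[𝒬^ρ_L, ψ̄]B (μ,y)| ≤ Σ_x Σ_α F α x·|count(α,x)|·|B α x|`. -/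
theorem abs_commutator_le_of_forall (hr : r ∈ box (d + 1) L) (ψ : Site (d + 1) → ℝ) (B : Form1 (d + 1) ℝ) (μ : Fin (d + 1)) (y : Site (d + 1))
    {F : Form1 (d + 1) ℝ}
    (hF : ∀ α x, |(ψ x + ψ (x + unitVec α) - ψ ((L : ℤ) • y + toSite r) - ψ ((L : ℤ) • y + toSite r + (L : ℤ) • unitVec μ))
        * (symLinCountAt (toSite r) L μ y (α, x) : ℝ)| ≤ F α x * |(symLinCountAt (toSite r) L μ y (α, x) : ℝ)|) :
    |symLinAvgAt (toSite r) (fun α x => (ψ x + ψ (x + unitVec α)) * B α x) L μ y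
        - (ψ ((L : ℤ) • y + toSite r) + ψ ((L : ℤ) • y + toSite r + (L : ℤ) • unitVec μ)) * symLinAvgAt (toSite r) B L μ y|
      ≤ ∑ x ∈ nearBox L y, ∑ α, F α x * |(symLinCountAt (toSite r) L μ y (α, x) : ℝ)| * |B α x| := by
  rw [commutator_eq_sum hr]
  refine (Finset.abs_sum_le_sum_abs _ _).trans (Finset.sum_le_sum fun x _ => (Finset.abs_sum_le_sum_abs _ _).trans (Finset.sum_le_sum fun α _ => ?_))
  rw [abs_mul]
  exact mul_le_mul_of_nonneg_right (hF α x) (abs_nonneg _)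

/-! ## §2 Block-constant gauge functions -/

/-- NOT IN PRINT; OUR BOOKKEEPING.  **THE COMMUTATOR WITH A BLOCK-CONSTANT GAUGE FUNCTION IS THE ONE FACE JUMP TIMES THE CONTOUR MASS** (box root, `1 ≤ L`):
`ψ = h ∘ blk L` ⇒ `|[𝒬^ρ_L, ψ̄]B (μ,y)| ≤ |h(y+e_μ) − h y|·Σ_{x ∈ nearBox L y} Σ_α |linCountAt ρ L μ y (α,x)|·|B α x|`. -/
theorem abs_commutator_le_of_blockConst (hL : 1 ≤ L) (hr : r ∈ box (d + 1) L) {ψ : Site (d + 1) → ℝ} (h : Site (d + 1) → ℝ)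
    (hψ : ∀ u, ψ u = h (blk L u)) (B : Form1 (d + 1) ℝ) (μ : Fin (d + 1)) (y : Site (d + 1)) :
    |symLinAvgAt (toSite r) (fun α x => (ψ x + ψ (x + unitVec α)) * B α x) L μ y
        - (ψ ((L : ℤ) • y + toSite r) + ψ ((L : ℤ) • y + toSite r + (L : ℤ) • unitVec μ)) * symLinAvgAt (toSite r) B L μ y|
      ≤ |h (y + unitVec μ) - h y| * ∑ x ∈ nearBox L y, ∑ α, |(symLinCountAt (toSite r) L μ y (α, x) : ℝ)| * |B α x| := by
  refine (abs_commutator_le_of_forall hr ψ B μ y (F := fun _ _ => |h (y + unitVec μ) - h y|)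
    (fun α x => abs_weight_mul_symLinCountAt_le hL hr h hψ μ y α x)).trans (le_of_eq ?_)
  rw [Finset.mul_sum]
  refine Finset.sum_congr rfl fun x _ => ?_
  rw [Finset.mul_sum]
  refine Finset.sum_congr rfl fun α _ => ?_
  ring

/-! ## §3 Staircases -/

section Staircase

variable {Lc : ℕ} {rr : Fin (d + 1) → ℕ}

/-- NOT IN PRINT; OUR BOOKKEEPING.  **THE COMMUTATOR WITH A STAIRCASE GAUGE FUNCTION: THE FINEST PIECE + THE JUMPS OF THE CROSSED SCALES** (one step `L = Lc`, box root):
`|[𝒬^ρ_{Lc}, ψ̄]B (μ,y)| ≤ Σ_{x ∈ nearBox} Σ_α (|w₄(G 0; α,x; μ,y)| + J(μ,y))·|count(α,x)|·|B α x|`, `J(μ,y) = Σ_{s<n} |G (s+1) (blk (Lc^s) (y+e_μ)) − G (s+1) (blk (Lc^s) y)|`. -/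
theorem abs_commutator_le_of_staircase (hLc : 1 ≤ Lc) (hrr : rr ∈ box (d + 1) Lc) (G : ℕ → Site (d + 1) → ℝ) (n : ℕ)
    {ψ : Site (d + 1) → ℝ} (hψ : ∀ u, ψ u = ∑ s ∈ Finset.range (n + 1), G s (blk (Lc ^ s) u)) (B : Form1 (d + 1) ℝ) (μ : Fin (d + 1)) (y : Site (d + 1)) :
    |symLinAvgAt (toSite rr) (fun α x => (ψ x + ψ (x + unitVec α)) * B α x) Lc μ y
        - (ψ ((Lc : ℤ) • y + toSite rr) + ψ ((Lc : ℤ) • y + toSite rr + (Lc : ℤ) • unitVec μ)) * symLinAvgAt (toSite rr) B Lc μ y|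
      ≤ ∑ x ∈ nearBox Lc y, ∑ α,
          (|G 0 x + G 0 (x + unitVec α) - G 0 ((Lc : ℤ) • y + toSite rr) - G 0 ((Lc : ℤ) • y + toSite rr + (Lc : ℤ) • unitVec μ)|
            + ∑ s ∈ Finset.range n, |G (s + 1) (blk (Lc ^ s) (y + unitVec μ)) - G (s + 1) (blk (Lc ^ s) y)|)
          * |(symLinCountAt (toSite rr) Lc μ y (α, x) : ℝ)| * |B α x| := by
  refine abs_commutator_le_of_forall hrr ψ B μ y fun α x => ?_
  -- termwise: finest piece + block-constant part (PART 1 on `linCountAt`)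
  set q : ℝ := (symLinCountAt (toSite rr) Lc μ y (α, x) : ℝ)
  set hp : Site (d + 1) → ℝ := fun y' => ∑ s ∈ Finset.range n, G (s + 1) (blk (Lc ^ s) y') with hhp
  have hψ' : ∀ u, ψ u = G 0 u + hp (blk Lc u) := fun u => by rw [hψ, staircase_split]
  have e : (ψ x + ψ (x + unitVec α) - ψ ((Lc : ℤ) • y + toSite rr) - ψ ((Lc : ℤ) • y + toSite rr + (Lc : ℤ) • unitVec μ)) * q
      = (G 0 x + G 0 (x + unitVec α) - G 0 ((Lc : ℤ) • y + toSite rr) - G 0 ((Lc : ℤ) • y + toSite rr + (Lc : ℤ) • unitVec μ)) * q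
        + ((fun u => hp (blk Lc u)) x + (fun u => hp (blk Lc u)) (x + unitVec α) - (fun u => hp (blk Lc u)) ((Lc : ℤ) • y + toSite rr)
            - (fun u => hp (blk Lc u)) ((Lc : ℤ) • y + toSite rr + (Lc : ℤ) • unitVec μ)) * q := by
    simp only [hψ']; ring
  rw [e, add_mul]
  refine (abs_add_le _ _).trans (add_le_add (le_of_eq (abs_mul _ _)) ?_)
  refine (abs_weight_mul_symLinCountAt_le hLc hrr hp (fun _ => rfl) μ y α x).trans (mul_le_mul_of_nonneg_right ?_ (abs_nonneg _))
  rw [hhp]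
  exact abs_hplus_jump_le G n μ y

/-- NOT IN PRINT; OUR BOOKKEEPING.  **UNIFORM FORM** (the owner's A1 «`C_L·α·(Lc^{s(y,μ)} + 1)·sup_{pair}|B|`»): with a finest-piece letter `|w₄(G 0; α,x; μ,y)| ≤ W₀` and a leg
letter `|B α x| ≤ M` on the support box, `|[𝒬^ρ_{Lc}, ψ̄]B (μ,y)| ≤ (W₀ + J(μ,y))·M·Σ_{x ∈ nearBox} Σ_α |count(α,x)|`. -/
theorem abs_commutator_le_of_staircase_of_le (hLc : 1 ≤ Lc) (hrr : rr ∈ box (d + 1) Lc) (G : ℕ → Site (d + 1) → ℝ) (n : ℕ)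
    {ψ : Site (d + 1) → ℝ} (hψ : ∀ u, ψ u = ∑ s ∈ Finset.range (n + 1), G s (blk (Lc ^ s) u)) (B : Form1 (d + 1) ℝ) (μ : Fin (d + 1)) (y : Site (d + 1))
    {W₀ M : ℝ}
    (hW : ∀ α, ∀ x ∈ nearBox Lc y, |G 0 x + G 0 (x + unitVec α) - G 0 ((Lc : ℤ) • y + toSite rr) - G 0 ((Lc : ℤ) • y + toSite rr + (Lc : ℤ) • unitVec μ)| ≤ W₀)
    (hB : ∀ α, ∀ x ∈ nearBox Lc y, |B α x| ≤ M) :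
    |symLinAvgAt (toSite rr) (fun α x => (ψ x + ψ (x + unitVec α)) * B α x) Lc μ y
        - (ψ ((Lc : ℤ) • y + toSite rr) + ψ ((Lc : ℤ) • y + toSite rr + (Lc : ℤ) • unitVec μ)) * symLinAvgAt (toSite rr) B Lc μ y|
      ≤ (W₀ + ∑ s ∈ Finset.range n, |G (s + 1) (blk (Lc ^ s) (y + unitVec μ)) - G (s + 1) (blk (Lc ^ s) y)|) * M
          * ∑ x ∈ nearBox Lc y, ∑ α, |(symLinCountAt (toSite rr) Lc μ y (α, x) : ℝ)| := by
  refine (abs_commutator_le_of_staircase hLc hrr G n hψ B μ y).trans ?_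
  rw [Finset.mul_sum]
  refine Finset.sum_le_sum fun x hx => ?_
  rw [Finset.mul_sum]
  refine Finset.sum_le_sum fun α _ => ?_
  have hJ : 0 ≤ ∑ s ∈ Finset.range n, |G (s + 1) (blk (Lc ^ s) (y + unitVec μ)) - G (s + 1) (blk (Lc ^ s) y)| :=
    Finset.sum_nonneg fun _ _ => abs_nonneg _
  have h1 := hW α x hx
  have h2 := hB α x hx
  have hq := abs_nonneg (symLinCountAt (toSite rr) Lc μ y (α, x) : ℝ)
  have hW0 : 0 ≤ W₀ := (abs_nonneg _).trans h1
  calc (|G 0 x + G 0 (x + unitVec α) - G 0 ((Lc : ℤ) • y + toSite rr) - G 0 ((Lc : ℤ) • y + toSite rr + (Lc : ℤ) • unitVec μ)|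
            + ∑ s ∈ Finset.range n, |G (s + 1) (blk (Lc ^ s) (y + unitVec μ)) - G (s + 1) (blk (Lc ^ s) y)|)
          * |(symLinCountAt (toSite rr) Lc μ y (α, x) : ℝ)| * |B α x|
        ≤ (W₀ + ∑ s ∈ Finset.range n, |G (s + 1) (blk (Lc ^ s) (y + unitVec μ)) - G (s + 1) (blk (Lc ^ s) y)|)
          * |(symLinCountAt (toSite rr) Lc μ y (α, x) : ℝ)| * M :=
          mul_le_mul (mul_le_mul_of_nonneg_right (by linarith) hq) h2 (abs_nonneg _) (mul_nonneg (by linarith) hq)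
    _ = (W₀ + ∑ s ∈ Finset.range n, |G (s + 1) (blk (Lc ^ s) (y + unitVec μ)) - G (s + 1) (blk (Lc ^ s) y)|) * M
          * |(symLinCountAt (toSite rr) Lc μ y (α, x) : ℝ)| := by ring

/-! ## §4 The ΔΔ commutator: against the gradient of a second staircase the two coarse jump sums never multiply -/

/-- NOT IN PRINT; OUR BOOKKEEPING.  **THE ΔΔ COMMUTATOR** (one step `L = Lc`, box root; `B = dz ψ_b`, `ψ_a`, `ψ_b` staircases with pieces `Ga`, `Gb`):
`|[𝒬^ρ_{Lc}, ψ̄_a](dz ψ_b)(μ,y)| ≤ Σ_x Σ_α (|w₄(Ga 0; α,x; μ,y)|·(|dz (Gb 0) α x| + J_b(μ,y)) + J_a(μ,y)·|dz (Gb 0) α x|)·|count(α,x)|` — NO `J_a·J_b` term. -/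
theorem abs_commutator_dz_le_of_staircase (hLc : 1 ≤ Lc) (hrr : rr ∈ box (d + 1) Lc) (Ga Gb : ℕ → Site (d + 1) → ℝ) (na nb : ℕ)
    {ψa ψb : Site (d + 1) → ℝ} (hψa : ∀ u, ψa u = ∑ s ∈ Finset.range (na + 1), Ga s (blk (Lc ^ s) u))
    (hψb : ∀ u, ψb u = ∑ s ∈ Finset.range (nb + 1), Gb s (blk (Lc ^ s) u)) (μ : Fin (d + 1)) (y : Site (d + 1)) :
    |symLinAvgAt (toSite rr) (fun α x => (ψa x + ψa (x + unitVec α)) * dz ψb α x) Lc μ y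
        - (ψa ((Lc : ℤ) • y + toSite rr) + ψa ((Lc : ℤ) • y + toSite rr + (Lc : ℤ) • unitVec μ)) * symLinAvgAt (toSite rr) (dz ψb) Lc μ y|
      ≤ ∑ x ∈ nearBox Lc y, ∑ α,
          (|Ga 0 x + Ga 0 (x + unitVec α) - Ga 0 ((Lc : ℤ) • y + toSite rr) - Ga 0 ((Lc : ℤ) • y + toSite rr + (Lc : ℤ) • unitVec μ)|
              * (|dz (Gb 0) α x| + ∑ s ∈ Finset.range nb, |Gb (s + 1) (blk (Lc ^ s) (y + unitVec μ)) - Gb (s + 1) (blk (Lc ^ s) y)|)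
            + (∑ s ∈ Finset.range na, |Ga (s + 1) (blk (Lc ^ s) (y + unitVec μ)) - Ga (s + 1) (blk (Lc ^ s) y)|) * |dz (Gb 0) α x|)
          * |(symLinCountAt (toSite rr) Lc μ y (α, x) : ℝ)| := by
  rw [commutator_eq_sum hrr]
  refine (Finset.abs_sum_le_sum_abs _ _).trans (Finset.sum_le_sum fun x _ => (Finset.abs_sum_le_sum_abs _ _).trans (Finset.sum_le_sum fun α _ => ?_))
  have h := abs_weight_mul_dz_staircase_mul_symLinCountAt_le hLc hrr Ga Gb na nb hψa hψb μ y α x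
  have e : (ψa x + ψa (x + unitVec α) - ψa ((Lc : ℤ) • y + toSite rr) - ψa ((Lc : ℤ) • y + toSite rr + (Lc : ℤ) • unitVec μ))
        * (symLinCountAt (toSite rr) Lc μ y (α, x) : ℝ) * dz ψb α x
      = (ψa x + ψa (x + unitVec α) - ψa ((Lc : ℤ) • y + toSite rr) - ψa ((Lc : ℤ) • y + toSite rr + (Lc : ℤ) • unitVec μ))
        * (ψb (x + unitVec α) - ψb x) * (symLinCountAt (toSite rr) Lc μ y (α, x) : ℝ) := by
    simp only [dz]; ring
  rw [e]
  simpa only [dz] using h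

/-- NOT IN PRINT; OUR BOOKKEEPING.  **UNIFORM FORM OF THE ΔΔ COMMUTATOR** (the owner's A1 «`C_L·α²·(Lc^{s(y,μ)} + 1)`»): with finest-piece letters `|w₄(Ga 0; α,x; μ,y)| ≤ W_a` and
`|dz (Gb 0) α x| ≤ g_b` on the support box, `|[𝒬^ρ_{Lc}, ψ̄_a](dz ψ_b)(μ,y)| ≤ (W_a·(g_b + J_b(μ,y)) + J_a(μ,y)·g_b)·Σ_{x ∈ nearBox} Σ_α |count(α,x)|`. -/
theorem abs_commutator_dz_le_of_staircase_of_le (hLc : 1 ≤ Lc) (hrr : rr ∈ box (d + 1) Lc) (Ga Gb : ℕ → Site (d + 1) → ℝ) (na nb : ℕ)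
    {ψa ψb : Site (d + 1) → ℝ} (hψa : ∀ u, ψa u = ∑ s ∈ Finset.range (na + 1), Ga s (blk (Lc ^ s) u))
    (hψb : ∀ u, ψb u = ∑ s ∈ Finset.range (nb + 1), Gb s (blk (Lc ^ s) u)) (μ : Fin (d + 1)) (y : Site (d + 1))
    {Wa gb : ℝ} (hWa0 : 0 ≤ Wa)
    (hWa : ∀ α, ∀ x ∈ nearBox Lc y, |Ga 0 x + Ga 0 (x + unitVec α) - Ga 0 ((Lc : ℤ) • y + toSite rr) - Ga 0 ((Lc : ℤ) • y + toSite rr + (Lc : ℤ) • unitVec μ)| ≤ Wa)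
    (hgb : ∀ α, ∀ x ∈ nearBox Lc y, |dz (Gb 0) α x| ≤ gb) :
    |symLinAvgAt (toSite rr) (fun α x => (ψa x + ψa (x + unitVec α)) * dz ψb α x) Lc μ y
        - (ψa ((Lc : ℤ) • y + toSite rr) + ψa ((Lc : ℤ) • y + toSite rr + (Lc : ℤ) • unitVec μ)) * symLinAvgAt (toSite rr) (dz ψb) Lc μ y|
      ≤ (Wa * (gb + ∑ s ∈ Finset.range nb, |Gb (s + 1) (blk (Lc ^ s) (y + unitVec μ)) - Gb (s + 1) (blk (Lc ^ s) y)|)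
            + (∑ s ∈ Finset.range na, |Ga (s + 1) (blk (Lc ^ s) (y + unitVec μ)) - Ga (s + 1) (blk (Lc ^ s) y)|) * gb)
          * ∑ x ∈ nearBox Lc y, ∑ α, |(symLinCountAt (toSite rr) Lc μ y (α, x) : ℝ)| := by
  refine (abs_commutator_dz_le_of_staircase hLc hrr Ga Gb na nb hψa hψb μ y).trans ?_
  rw [Finset.mul_sum]
  refine Finset.sum_le_sum fun x hx => ?_
  rw [Finset.mul_sum]
  refine Finset.sum_le_sum fun α _ => ?_
  have hJa : 0 ≤ ∑ s ∈ Finset.range na, |Ga (s + 1) (blk (Lc ^ s) (y + unitVec μ)) - Ga (s + 1) (blk (Lc ^ s) y)| :=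
    Finset.sum_nonneg fun _ _ => abs_nonneg _
  have hJb : 0 ≤ ∑ s ∈ Finset.range nb, |Gb (s + 1) (blk (Lc ^ s) (y + unitVec μ)) - Gb (s + 1) (blk (Lc ^ s) y)| :=
    Finset.sum_nonneg fun _ _ => abs_nonneg _
  have h1 := hWa α x hx
  have h2 := hgb α x hx
  have h0 := abs_nonneg (Ga 0 x + Ga 0 (x + unitVec α) - Ga 0 ((Lc : ℤ) • y + toSite rr) - Ga 0 ((Lc : ℤ) • y + toSite rr + (Lc : ℤ) • unitVec μ))
  have h0' := abs_nonneg (dz (Gb 0) α x)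
  exact mul_le_mul_of_nonneg_right (by gcongr) (abs_nonneg _)

end Staircase

/-! ## §5 The crude contour-mass constant -/

/-- [folklore] `Σ_{x ∈ nearBox L y} Σ_α |symLinCountAt ρ L μ y (α,x)| ≤ #nearBox·(d+1)·((d+1)!·(L^{d+1}·ell (d+1) L))` (an1's `abs_symLinCountAt_le` per bond; box root, `1 ≤ L`). -/
theorem sum_abs_symLinCountAt_le (hL : 1 ≤ L) (hr : r ∈ box (d + 1) L) (μ : Fin (d + 1)) (y : Site (d + 1)) :
    ∑ x ∈ nearBox L y, ∑ α, |(symLinCountAt (toSite r) L μ y (α, x) : ℝ)|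
      ≤ (nearBox L y).card * ((d + 1 : ℕ) * ((((d + 1).factorial : ℕ) : ℝ) * ((L : ℝ) ^ (d + 1) * (ell (d + 1) L : ℝ)))) := by
  have hb : ∀ x ∈ nearBox L y, ∑ α, |(symLinCountAt (toSite r) L μ y (α, x) : ℝ)|
      ≤ (d + 1 : ℕ) * ((((d + 1).factorial : ℕ) : ℝ) * ((L : ℝ) ^ (d + 1) * (ell (d + 1) L : ℝ))) := by
    intro x _
    have h1 : ∀ α ∈ (Finset.univ : Finset (Fin (d + 1))), |(symLinCountAt (toSite r) L μ y (α, x) : ℝ)|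
        ≤ (((d + 1).factorial : ℕ) : ℝ) * ((L : ℝ) ^ (d + 1) * (ell (d + 1) L : ℝ)) := by
      intro α _
      have h := abs_symLinCountAt_le hL μ y hr (α, x)
      rw [← Int.cast_abs]
      exact_mod_cast h
    refine (Finset.sum_le_sum h1).trans (le_of_eq ?_)
    rw [Finset.sum_const, Finset.card_univ, Fintype.card_fin, nsmul_eq_mul]
  refine (Finset.sum_le_sum hb).trans (le_of_eq ?_)
  rw [Finset.sum_const, nsmul_eq_mul]

end Summit.QuantumFields.BalabanUV.Beta.GAN24.SymContactFaceJumpCommutator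

end
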